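import Literature.NumberTheory.Transcendental.KZDominatedFamily

/-!
# Route ValuedFieldSpecialisation — crux `CTConstruction`: dilations of the parameter preserve dominated families

Helper toward crux stmt-KontsevichZagierPeriods-3495 (`CTConstruction`), line `registered`, stub
`stub_isDominatedFamily_dilate`. An `(n+1)`-dimensional integral representation `S` is read as the
one-parameter family of its slices over the parameter `s = z 0`; `KZ.IsDominatedFamily S r₀ g`
(`Literature/NumberTheory/Transcendental/KZDominatedFamily.lean`) says that the family is dominated near
`s = 0⁺` by the envelope `g` and has the a.e. special fibre `r₀` (the three hypotheses of Lebesgue's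
dominated convergence theorem along `𝓝[>] 0`). The operator toolkit of the constant-term construction uses
the Jacobian-free DILATIONS `T_μ` of the base, `s ↦ μ s` for a rational `μ > 0`: the dilate `S'` of `S`
has domain `{z | update z 0 (μ z 0) ∈ S.domain}` and integrand `z ↦ S.integrand (update z 0 (μ z 0))`,
i.e. it is the family `t ↦ S_{μ t}`. This file records the bookkeeping fact that **`T_μ` maps dominated
pairs `(S, r₀)` to dominated pairs `(T_μ S, r₀)` with the same envelope** (`stub_isDominatedFamily_dilate`):

* clause (1) holds with `ε / μ` in place of `ε`, because `update z 0 (μ z 0)` has parameter `μ z 0` and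
  the same fibre coordinates as `z` (`tail_update_zero_eq`);
* clauses (2) and (3) pull back along the reparametrisation `t ↦ μ t`, which tends to `𝓝[>] 0` along
  `𝓝[>] 0` (`tendsto_const_mul_nhdsGT_zero`), using `update (vecCons t x) 0 (μ t) = vecCons (μ t) x`
  (`update_vecCons_zero`); the exceptional null sets of `x` are unchanged.

Sources: M. Kontsevich, D. Zagier, *Periods* (2001), §1.2 (the moves); folklore (substitution in a
one-parameter limit). No new definitions; nothing here about the existence of the dilate as an integral
representation or about fibred relations (sibling files).
-/

noncomputable section

namespace Summit.KontsevichZagierPeriods.ValuedFieldSpecialisation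

open MeasureTheory Set Filter
open scoped Topology
open Literature.NumberTheory.Transcendental Literature.NumberTheory.Transcendental.KZ

variable {n : ℕ}

/-- Updating the parameter coordinate of a slice point: `update (s, x) 0 c = (c, x)`, i.e.
`Function.update (vecCons s x) 0 c = vecCons c x` (`Fin.update_cons_zero`). [folklore] -/
private theorem update_vecCons_zero (s c : ℝ) (x : Fin n → ℝ) :
    Function.update (Matrix.vecCons s x) 0 c = Matrix.vecCons c x :=
  Fin.update_cons_zero (α := fun _ : Fin (n + 1) => ℝ) s x c

/-- Updating the parameter coordinate does not change the fibre coordinates: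
`(update z 0 c) ∘ Fin.succ = z ∘ Fin.succ` (`Function.update_of_ne`, `Fin.succ_ne_zero`). [folklore] -/
private theorem tail_update_zero_eq (z : Fin (n + 1) → ℝ) (c : ℝ) :
    (fun i : Fin n => Function.update z 0 c i.succ) = fun i : Fin n => z i.succ := by
  funext i
  exact Function.update_of_ne (Fin.succ_ne_zero i) _ _

/-- The dilation `t ↦ μ t` of the parameter by `μ > 0` tends to `0⁺` along `0⁺`:
`Tendsto (μ * ·) (𝓝[>] 0) (𝓝[>] 0)` (continuity of multiplication at `0` and `μ t > 0` for `t > 0`).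
[folklore] -/
private theorem tendsto_const_mul_nhdsGT_zero {μ : ℝ} (hμ : 0 < μ) :
    Tendsto (fun t : ℝ => μ * t) (𝓝[>] 0) (𝓝[>] 0) := by
  refine tendsto_nhdsWithin_iff.2 ⟨?_, ?_⟩
  · have h : Tendsto (fun t : ℝ => μ * t) (𝓝 0) (𝓝 (μ * 0)) := (continuous_const_mul μ).tendsto 0
    rw [mul_zero] at h
    exact h.mono_left nhdsWithin_le_nhds
  · exact eventually_mem_nhdsWithin.mono fun t ht => mul_pos hμ ht

/-- **Dilations of the parameter preserve dominated families** (stub `stub_isDominatedFamily_dilate` of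
crux `CTConstruction`): if the family `S` (read over `s = z 0`) is dominated near `s = 0⁺` by `g` with
a.e. special fibre `r₀`, and `S'` is its Jacobian-free dilate by a rational `μ > 0` — domain
`{z | update z 0 (μ z 0) ∈ S.domain}`, integrand `z ↦ S.integrand (update z 0 (μ z 0))`, i.e. the family
`t ↦ S_{μ t}` — then `S'` is again dominated by the same `g` with the same special fibre `r₀`: clause (1)
with `ε / μ`, clauses (2), (3) by composing with `t ↦ μ t → 0⁺`.
[Kontsevich–Zagier 2001, §1.2; Lebesgue] [folklore] -/
theorem stub_isDominatedFamily_dilate : ∀ (μ : ℚ), 0 < μ → ∀ (n : ℕ) (S S' : Literature.NumberTheory.Transcendental.KZ.IntegralRep (n + 1)) (r₀ g : Literature.NumberTheory.Transcendental.KZ.IntegralRep n), Literature.NumberTheory.Transcendental.KZ.IsDominatedFamily S r₀ g → S'.domain = {z | Function.update z 0 ((μ : ℝ) * z 0) ∈ S.domain} → S'.integrand = (fun z => S.integrand (Function.update z 0 ((μ : ℝ) * z 0))) → Literature.NumberTheory.Transcendental.KZ.IsDominatedFamily S' r₀ g := by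
  intro μ hμ n S S' r₀ g h hdom hint
  have hμ' : (0 : ℝ) < μ := Rat.cast_pos.mpr hμ
  obtain ⟨⟨ε, hε, hbd⟩, hmem, hlim⟩ := h
  refine ⟨⟨ε / μ, div_pos hε hμ', fun z hz h0 hzε => ?_⟩, ?_, ?_⟩
  · -- clause (1): the point `update z 0 (μ z 0) ∈ S.domain` has parameter in `(0, ε)`, same fibre point
    rw [hdom] at hz
    have h0' : 0 < Function.update z 0 ((μ : ℝ) * z 0) 0 := by
      rw [Function.update_self]
      exact mul_pos hμ' h0
    have hε' : Function.update z 0 ((μ : ℝ) * z 0) 0 < ε := by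
      rw [Function.update_self]
      exact (lt_div_iff₀' hμ').mp hzε
    obtain ⟨hg, hle⟩ := hbd _ hz h0' hε'
    rw [tail_update_zero_eq] at hg hle
    refine ⟨hg, ?_⟩
    rw [hint]
    exact hle
  · -- clause (2): pull back the eventual slice membership along `t ↦ μ t`
    filter_upwards [hmem] with x hx
    filter_upwards [(tendsto_const_mul_nhdsGT_zero hμ').eventually hx] with t ht
    rw [hdom, mem_setOf_eq, Matrix.cons_val_zero, update_vecCons_zero]
    exact ht
  · -- clause (3): pull back the convergence of the integrands along `t ↦ μ t`
    filter_upwards [hlim] with x hx hxr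
    have heq : (fun s : ℝ => S'.integrand (Matrix.vecCons s x)) =
        (fun s : ℝ => S.integrand (Matrix.vecCons s x)) ∘ fun t : ℝ => (μ : ℝ) * t := by
      funext t
      simp only [Function.comp_apply, hint, Matrix.cons_val_zero, update_vecCons_zero]
    rw [heq]
    exact (hx hxr).comp (tendsto_const_mul_nhdsGT_zero hμ')

end Summit.KontsevichZagierPeriods.ValuedFieldSpecialisation
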